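import Summits.CriticalPhenomena.PercolationContinuityZ3.Theorems.Transplant.FKConnectivityAllQAntipodalRootFormCert
import HarnessLib

/-!
# Connectivity correlation inequalities for `φ_{w,q}` — ROOT-FORM CALCULUS, file 72a (DEFINITIONS): the GLUE(2,1) PARALLEL certificate —
# local types of a two-special environment, generator families, the three-special target, and the E₁-side multiplier table

Definitions file (`--supports stmt-CriticalPhenomena-4575`), FK sub-lane `prim-bschramm-fk-2` (gen 31); builds on p205010 (kernel theorem, internal audit
signed; external expert review pending).  No theorems beyond `decide`d table facts, no named facts, no sorries.  Memo FROM-fk-2-g31-DUALITY.md §6 (G2),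
FROM-fk-2-g29-BRIDGE.md §8 (GLUE(2,1) by certificate).

THE OBJECT.  A two-special environment `E₁` (TTSP with specials `y, z`) glued IN PARALLEL with a one-special box `B` (special `w`) between the ends of
the root `x`: the base junction of the `T2⁺` pipeline once the split node is parallel (file 71b makes it so).  Fact 1 of `E₁ ∥ B` (the nested
three-special root functional `≥ 0`) is a FIBREWISE consequence of known facts of `E₁` (nested maj₃ root functional F1, its parallel transform summed
F2sum, contracted AND F4, the pivot facts Ucon/Uex of `E₁` read as a box with special `y` or `z`) and of the box axioms A1/A3n/A4n of `B` — fk-2 g29's LP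
certificate (kit j223500; 1 332 multipliers in `(1/16)ℤ`, re-verified exactly by fk-2 g31).  This file fixes, in the style of file 61d (`Cert.*`):
* `PT` — the LOCAL TYPE of a two-special configuration: offsets `ΔΛ_y, ΔΛ_z, ΔΛ_yz` of the pattern levels relative to `Λ_∅` and the pole bits
  `K¹_P, K²_P` (`P ∈ {∅, y, z, yz}`); `consistentP` = the local consistency constraints (bits monotone along the pattern cube, steps `ΔΛ = a + b`,
  `a ∈ {−1,0}` forced `−1` when `K¹` rises, `b ∈ {0,1}` forced `1` when `K²` falls) — 304 of the 11 520 sign patterns (`allPT`);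
* the generator families as integer functions of the local type and a threshold, with their SLOT ASSIGNMENT (which of the two nested weights
  `h₁ ≥ h₀` multiplies each part): `EF` (E₁-side: `F1`, `F2sum`, `F4`, `Ucony`, `Uconz`, `Uexy`) evaluated by `evalE`, `BF` (box side: `A1`, `A3`, `A4`,
  the 61d atoms `Cert.A1/A3u/A3l/A4u/A4l`) evaluated by `evalB`; each returns the pair (slot-1 part, slot-0 part);
* the TARGET `X1`, `X0`: the two slots of the three-special nested root functional of the composite at threshold `k` relative to `Λ_∅ + L⁰`
  (composite levels `Λ' = ΔΛ_P + L_s + [K¹_P ∧ c_s] + [K²_P ∧ c̄_s]`, bits `K¹_P ∨ c_s`, `K²_P ∨ c̄_s`; `a`-terms at the patterns `∅` and `{y,z,w}`,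
  `r`-terms at the six mixed patterns — `FK.RootForm.Gen.EDat.gslot1/gslot0` for three specials);
* `E21` — the E₁-side multipliers (×16) keyed by the box type (86 entries) and `rowE` (their contribution at a row); the box-side table keyed by
  the 304 pair types, in chunks of four with one kernel-checked `decide` per chunk, and their assembly are files 72b–72e.
Semantics are those of fk-2 g29's `lab/kit29i/glue_lp4.py` (`pair_generators`, `box_generators`, `t2_slots`), frozen in HOME/prim-bschramm-fk-2-g31/
lab/certpar/{glue_lp4_pure.py, verify_exact.py, cert_par_table.tsv}.
[folklore]
-/

namespace Summit.CriticalPhenomena.PercolationContinuityZ3.Theorems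

namespace FK

namespace RootForm

namespace Cert3

open Cert

/-- Local type of a two-special configuration: level offsets of the patterns `y, z, yz` relative to `∅`, and the pole bits `K¹_P` (`a*`) and
`K²_P` (`b*`) of the four patterns. [folklore] -/
structure PT where
  /-- `Λ_y − Λ_∅` -/
  dy : ℤ
  /-- `Λ_z − Λ_∅` -/
  dz : ℤ
  /-- `Λ_yz − Λ_∅` -/
  dyz : ℤ
  /-- `K¹_∅` -/
  a0 : Bool
  /-- `K¹_y` -/
  ay : Bool
  /-- `K¹_z` -/
  az : Bool
  /-- `K¹_yz` -/
  ayz : Bool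
  /-- `K²_∅` -/
  b0 : Bool
  /-- `K²_y` -/
  bY : Bool
  /-- `K²_z` -/
  bz : Bool
  /-- `K²_yz` -/
  byz : Bool
deriving DecidableEq

/-- level offset of pattern `P` (`0 = ∅, 1 = y, 2 = z, 3 = yz`). [folklore] -/
def PT.dL (τ : PT) : Fin 4 → ℤ
  | 0 => 0
  | 1 => τ.dy
  | 2 => τ.dz
  | 3 => τ.dyz
/-- replica-1 pole bit of pattern `P`. [folklore] -/
def PT.K1 (τ : PT) : Fin 4 → Bool
  | 0 => τ.a0
  | 1 => τ.ay
  | 2 => τ.az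
  | 3 => τ.ayz
/-- replica-2 pole bit of pattern `P`. [folklore] -/
def PT.K2 (τ : PT) : Fin 4 → Bool
  | 0 => τ.b0
  | 1 => τ.bY
  | 2 => τ.bz
  | 3 => τ.byz

/-- one edge `P → Q` of the pattern cube is locally consistent. [folklore] -/
def stepOK (τ : PT) (P Q : Fin 4) : Bool :=
  (!τ.K1 P || τ.K1 Q) && (!τ.K2 Q || τ.K2 P) &&
    decide ((-1 : ℤ) + (if τ.K2 P && !τ.K2 Q then 1 else 0) ≤ τ.dL Q - τ.dL P) &&
    decide (τ.dL Q - τ.dL P ≤ (if !τ.K1 P && τ.K1 Q then (-1 : ℤ) else 0) + 1)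
/-- The local consistency constraints of a two-special local type. [folklore] -/
def consistentP (τ : PT) : Bool := stepOK τ 0 1 && stepOK τ 0 2 && stepOK τ 1 3 && stepOK τ 2 3

/-- All 11 520 sign patterns with offsets in the a-priori windows. [folklore] -/
def allPT : List PT :=
  [-1, 0, 1].flatMap fun dy => [-1, 0, 1].flatMap fun dz => [-2, -1, 0, 1, 2].flatMap fun dyz =>
  [false, true].flatMap fun a0 => [false, true].flatMap fun ay => [false, true].flatMap fun az => [false, true].flatMap fun ayz =>
  [false, true].flatMap fun b0 => [false, true].flatMap fun bY => [false, true].flatMap fun bz => [false, true].map fun byz =>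
    (⟨dy, dz, dyz, a0, ay, az, ayz, b0, bY, bz, byz⟩ : PT)

/-! ### Atoms and generator families -/

/-- contracted-root atom `[ΔΛ_P + K¹_P + K²_P ≤ kp]`. [folklore] -/
def con (τ : PT) (P : Fin 4) (kp : ℤ) : ℤ := I (τ.dL P + bi (τ.K1 P) + bi (τ.K2 P) ≤ kp)
/-- exact-level atom `[ΔΛ_P = kp]·(K¹_P − K²_P)`. [folklore] -/
def exd (τ : PT) (P : Fin 4) (kp : ℤ) : ℤ := I (τ.dL P = kp) * (bi (τ.K1 P) - bi (τ.K2 P))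
/-- slot-1 integrand of the nested maj₃ root functional of `E₁` at relative threshold `kp`. [folklore] -/
def mv1 (τ : PT) (kp : ℤ) : ℤ :=
  I (τ.dL 0 + bi (τ.K1 0) ≤ kp) - I (τ.dL 3 + bi (τ.K1 3) ≤ kp) + bi (τ.K1 1) * I (τ.dL 1 = kp) + bi (τ.K1 2) * I (τ.dL 2 = kp)
/-- slot-0 integrand of the nested maj₃ root functional. [folklore] -/
def mv0 (τ : PT) (kp : ℤ) : ℤ :=
  I (τ.dL 0 + bi (τ.K2 0) ≤ kp) - I (τ.dL 3 + bi (τ.K2 3) ≤ kp) - bi (τ.K2 1) * I (τ.dL 1 = kp) - bi (τ.K2 2) * I (τ.dL 2 = kp)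
/-- slot-1 integrand of maj₃ for `g ∥ E₁` at `g`-state `b` (levels `ΔΛ_P + [b]K¹_P + [¬b]K²_P`, bits `b ∨ K¹`, `¬b ∨ K²`). [folklore] -/
def pv1 (τ : PT) (b : Bool) (kp : ℤ) : ℤ :=
  I (τ.dL 0 + bi (if b then τ.K1 0 else τ.K2 0) + bi (b || τ.K1 0) ≤ kp) - I (τ.dL 3 + bi (if b then τ.K1 3 else τ.K2 3) + bi (b || τ.K1 3) ≤ kp)
    + bi (b || τ.K1 1) * I (τ.dL 1 + bi (if b then τ.K1 1 else τ.K2 1) = kp) + bi (b || τ.K1 2) * I (τ.dL 2 + bi (if b then τ.K1 2 else τ.K2 2) = kp)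
/-- slot-0 integrand of maj₃ for `g ∥ E₁` at `g`-state `b`. [folklore] -/
def pv0 (τ : PT) (b : Bool) (kp : ℤ) : ℤ :=
  I (τ.dL 0 + bi (if b then τ.K1 0 else τ.K2 0) + bi (!b || τ.K2 0) ≤ kp) - I (τ.dL 3 + bi (if b then τ.K1 3 else τ.K2 3) + bi (!b || τ.K2 3) ≤ kp)
    - bi (!b || τ.K2 1) * I (τ.dL 1 + bi (if b then τ.K1 1 else τ.K2 1) = kp) - bi (!b || τ.K2 2) * I (τ.dL 2 + bi (if b then τ.K1 2 else τ.K2 2) = kp)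

/-- E₁-side generator families with their slot assignment (`true` = the part is weighted by `h₁`, `false` = by `h₀`). [folklore] -/
inductive EF
  /-- nested maj₃ root functional: slot of the `v1` part, slot of the `v0` part -/
  | F1 (hi lw : Bool)
  /-- its parallel transform, `g`-state summed -/
  | F2sum (hi lw : Bool)
  /-- contracted AND `[…∅… ≤ k] − […yz… ≤ k]` -/
  | F4 (s : Bool)
  /-- contracted pivot in `y` (A1 of `E₁` as a `y`-box), parts at `z`-state 0 / 1 -/
  | Ucony (a0 a1 : Bool)
  /-- contracted pivot in `z`, parts at `y`-state 0 / 1 -/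
  | Uconz (a0 a1 : Bool)
  /-- exact-level root-U in `y` (A4n of `E₁` as a `y`-box), parts `h0 l0` at `z`-state 0 and `h1 l1` at `z`-state 1 -/
  | Uexy (h0 h1 l0 l1 : Bool)
deriving DecidableEq

/-- Box-side generator families (61d atoms) with slot assignment. [folklore] -/
inductive BF
  /-- A1 (pivot, virtual root contracted) -/
  | A1 (s : Bool)
  /-- A3n (pivot, root free, nested): slots of the upper / lower part (`hi`, `lw`) -/
  | A3 (hi lw : Bool)
  /-- A4n (root-U at exact level, nested) -/
  | A4 (hi lw : Bool)
deriving DecidableEq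

/-- put the value `v` into slot `s`. [folklore] -/
def put (s : Bool) (v : ℤ) : ℤ × ℤ := if s then (v, 0) else (0, v)
/-- componentwise sum. [folklore] -/
def add2 (p q : ℤ × ℤ) : ℤ × ℤ := (p.1 + q.1, p.2 + q.2)
/-- scalar multiple. [folklore] -/
def smul2 (n : ℤ) (p : ℤ × ℤ) : ℤ × ℤ := (n * p.1, n * p.2)

/-- (slot-1, slot-0) contribution of an E₁-side generator at relative threshold `kp`. [folklore] -/
def evalE (f : EF) (τ : PT) (kp : ℤ) : ℤ × ℤ :=
  match f with
  | .F1 hi lw => add2 (put hi (mv1 τ kp)) (put lw (mv0 τ kp))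
  | .F2sum hi lw => add2 (put hi (pv1 τ false kp + pv1 τ true kp)) (put lw (pv0 τ false kp + pv0 τ true kp))
  | .F4 s => put s (con τ 0 kp - con τ 3 kp)
  | .Ucony a0 a1 => add2 (put a0 (con τ 0 kp - con τ 1 kp)) (put a1 (con τ 2 kp - con τ 3 kp))
  | .Uconz a0 a1 => add2 (put a0 (con τ 0 kp - con τ 2 kp)) (put a1 (con τ 1 kp - con τ 3 kp))
  | .Uexy h0 h1 l0 l1 => add2 (add2 (put h0 (exd τ 1 kp)) (put l0 (exd τ 0 kp))) (add2 (put h1 (exd τ 3 kp)) (put l1 (exd τ 2 kp)))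

/-- (slot-1, slot-0) contribution of a box-side generator at relative threshold `kb`. [folklore] -/
def evalB (f : BF) (t : BT) (kb : ℤ) : ℤ × ℤ :=
  match f with
  | .A1 s => put s (A1 t kb)
  | .A3 hi lw => add2 (put hi (A3u t kb)) (put lw (A3l t kb))
  | .A4 hi lw => add2 (put hi (A4u t kb)) (put lw (A4l t kb))

/-! ### The three-special target of the composite `E₁ ∥ B` -/

/-- level of the composite at pattern `P` of `E₁` and state `s` of `w`, relative to `Λ_∅ + L⁰`. [folklore] -/
def lam (τ : PT) (t : BT) (P : Fin 4) (s : Bool) : ℤ := τ.dL P + lev t s + bi (τ.K1 P && ccB t s) + bi (τ.K2 P && cbB t s)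
/-- replica-1 pole bit of the composite. [folklore] -/
def C1 (τ : PT) (t : BT) (P : Fin 4) (s : Bool) : Bool := τ.K1 P || ccB t s
/-- replica-2 pole bit of the composite. [folklore] -/
def C2 (τ : PT) (t : BT) (P : Fin 4) (s : Bool) : Bool := τ.K2 P || cbB t s
/-- the six mixed patterns of `{y,z,w}` as (pattern of `E₁`, state of `w`). [folklore] -/
def mixed3 : List (Fin 4 × Bool) := [(0, true), (1, false), (1, true), (2, false), (2, true), (3, false)]
/-- slot-1 integrand of the nested three-special root functional of `E₁ ∥ B`. [folklore] -/
def X1 (τ : PT) (t : BT) (k : ℤ) : ℤ :=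
  I (lam τ t 0 false + bi (C1 τ t 0 false) ≤ k) - I (lam τ t 3 true + bi (C1 τ t 3 true) ≤ k)
    + (mixed3.map fun q => bi (C1 τ t q.1 q.2) * I (lam τ t q.1 q.2 = k)).sum
/-- slot-0 integrand. [folklore] -/
def X0 (τ : PT) (t : BT) (k : ℤ) : ℤ :=
  I (lam τ t 0 false + bi (C2 τ t 0 false) ≤ k) - I (lam τ t 3 true + bi (C2 τ t 3 true) ≤ k)
    - (mixed3.map fun q => bi (C2 τ t q.1 q.2) * I (lam τ t q.1 q.2 = k)).sum

/-! ### The E₁-side table and the row check -/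

/-- E₁-side multipliers (×16) keyed by the box type: for each of the 21 consistent box types `t` (in the order of `Cert.T21`) the list of
(E₁-fact family with slot assignment, shift `d`, multiplier). [folklore] -/
def E21 : List (Cert.BT × List (EF × ℤ × ℤ)) := [
  (⟨false, false, false, false, (-1)⟩, [(.F1 true false, (-1), 8), (.F1 true false, 0, 8), (.Uexy true true true true, (-1), 8),
      (.Uexy false false false false, 0, 8)]),
  (⟨false, false, false, false, 0⟩, [(.F1 true true, 0, 8), (.F1 false false, 0, 8), (.Uexy true true false false, 0, 16)]),
  (⟨false, false, false, false, 1⟩, [(.F1 true false, 0, 8), (.F1 true false, 1, 8), (.Uexy true true true true, 1, 8), (.Uexy false false false false, 0, 8)]),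
  (⟨false, false, true, false, 0⟩, [(.F1 true false, 0, 8), (.F4 true, 0, 8), (.F4 false, 0, 8), (.Uexy true true true true, 0, 8),
      (.Uexy false false false false, 1, 8)]),
  (⟨false, false, true, false, 1⟩, [(.F2sum true true, 0, 4), (.F2sum false false, 0, 4), (.Uexy true true false true, 1, 12),
      (.Uexy false false false false, 1, 4)]),
  (⟨false, false, true, true, (-1)⟩, [(.F1 true false, 0, 8), (.F4 true, 0, 8), (.F4 false, 0, 8), (.Uexy false false false false, 1, 8)]),
  (⟨false, false, true, true, 0⟩, [(.F2sum true true, 0, 4), (.F2sum false false, 0, 4), (.Uexy false true false false, 1, 4),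
      (.Uexy false false false false, 1, 4)]),
  (⟨false, false, true, true, 1⟩, [(.F1 false false, 2, 8), (.Ucony true true, 0, 4), (.Ucony false false, 0, 4), (.Uexy true true true true, 1, 4),
      (.Uexy false false false false, 1, 4), (.Uconz true true, 0, 4), (.Uconz false false, 0, 4)]),
  (⟨false, true, false, false, (-1)⟩, [(.F2sum true true, (-1), 4), (.F2sum false false, (-1), 4), (.Uexy true true true true, 0, 4),
      (.Uexy false false false false, 0, 12)]),
  (⟨false, true, false, false, 0⟩, [(.F1 true false, 0, 8), (.F4 true, 0, 8), (.Ucony false false, 0, 4), (.Uexy true true true true, 1, 8),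
      (.Uexy true true false true, 0, 4), (.Uexy false false false false, 0, 4), (.Uconz false false, 0, 4)]),
  (⟨false, true, true, false, 0⟩, [(.F4 true, 0, 16), (.F4 false, 0, 16), (.Uexy true true true true, 1, 8), (.Uexy false false false false, 1, 8)]),
  (⟨false, true, true, true, (-1)⟩, [(.F4 true, 0, 16), (.F4 false, 0, 16), (.Uexy false false false false, 1, 8)]),
  (⟨false, true, true, true, 0⟩, [(.F4 true, 1, 4), (.F4 false, 1, 12), (.Ucony false false, 0, 8), (.Uexy false false false false, 1, 8),
      (.Uconz true true, 0, 8)]),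
  (⟨true, true, false, false, (-1)⟩, [(.F1 true true, 1, 8), (.F4 false, (-1), 8), (.Ucony true true, (-1), 4), (.Uexy false true false true, 0, 4),
      (.Uexy false false false false, 0, 4), (.Uconz true true, (-1), 4)]),
  (⟨true, true, false, false, 0⟩, [(.F2sum true true, 0, 4), (.F2sum false false, 0, 4), (.Uexy true true true true, 1, 4),
      (.Uexy true true false true, 1, 4)]),
  (⟨true, true, false, false, 1⟩, [(.F1 true false, 1, 8), (.F4 true, 1, 8), (.F4 false, 1, 8), (.Uexy true true true true, 2, 8)]),
  (⟨true, true, true, false, 0⟩, [(.F4 true, 1, 16), (.Ucony false false, 0, 8), (.Uexy true true false false, 1, 8), (.Uconz false false, 0, 8)]),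
  (⟨true, true, true, false, 1⟩, [(.F4 true, 1, 16), (.Ucony false true, 1, 8), (.Uexy true true true true, 2, 8), (.Uconz false true, 1, 8)]),
  (⟨true, true, true, true, (-1)⟩, [(.F4 true, 0, 16), (.F4 true, 1, 16)]),
  (⟨true, true, true, true, 0⟩, [(.Ucony false true, 1, 16), (.Uconz false true, 1, 16)]),
  (⟨true, true, true, true, 1⟩, [(.F4 false, 1, 16), (.F4 false, 2, 16)])]

/-- total (slot-1, slot-0) contribution of a list of E₁-side entries at the row threshold `k`. [folklore] -/
def rowE (es : List (EF × ℤ × ℤ)) (τ : PT) (k : ℤ) : ℤ × ℤ :=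
  es.foldl (fun acc e => add2 acc (smul2 e.2.2 (evalE e.1 τ (k - e.2.1)))) (0, 0)
/-- total contribution of a list of box-side entries. [folklore] -/
def rowB (bs : List (BF × ℤ × ℤ)) (t : BT) (k : ℤ) : ℤ × ℤ :=
  bs.foldl (fun acc e => add2 acc (smul2 e.2.2 (evalB e.1 t (k - e.2.1)))) (0, 0)
/-- the residual `(ρ₁, ρ₀) = 16·(X1, X0) − (E₁-side) − (box-side)` of a row. [folklore] -/
def rho (τ : PT) (bs : List (BF × ℤ × ℤ)) (t : BT) (es : List (EF × ℤ × ℤ)) (k : ℤ) : ℤ × ℤ :=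
  (16 * X1 τ t k - (rowE es τ k).1 - (rowB bs t k).1, 16 * X0 τ t k - (rowE es τ k).2 - (rowB bs t k).2)
/-- transport conditions `ρ₁ ≥ 0`, `ρ₁ + ρ₀ ≥ 0` of one row. [folklore] -/
def checkRow (τ : PT) (bs : List (BF × ℤ × ℤ)) (t : BT) (es : List (EF × ℤ × ℤ)) (k : ℤ) : Bool :=
  decide (0 ≤ (rho τ bs t es k).1) && decide (0 ≤ (rho τ bs t es k).1 + (rho τ bs t es k).2)
/-- the window of relative thresholds (every target and generator term vanishes for `k ≤ −5` and for `7 ≤ k`: offsets `ΔΛ ∈ [−2,2]`,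
`L¹ − L⁰ ∈ [−1,1]`, shifts `d ∈ [−2,3]`). [folklore] -/
def ks : List ℤ := [-4, -3, -2, -1, 0, 1, 2, 3, 4, 5, 6]
/-- all rows of one pair type with its box-side entries: every box type (with its E₁-side entries) and every threshold. [folklore] -/
def checkTau (p : PT × List (BF × ℤ × ℤ)) : Bool := E21.all fun q => ks.all fun k => checkRow p.1 p.2 q.1 q.2 k

/-- `E21` lists exactly the 21 consistent box types, in the order of `Cert.T21`. [folklore] -/
theorem E21_fst : E21.map Prod.fst = T21 := by decide +kernel

/-- the 304 locally consistent two-special types. [folklore] -/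
theorem length_filter_consistentP : (allPT.filter consistentP).length = 304 := by decide +kernel

end Cert3

end RootForm

end FK

end Summit.CriticalPhenomena.PercolationContinuityZ3.Theorems
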